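import Summits.QuantumFields.BalabanUV.Beta.EriceRemainderEnclosureHistoryAutonomyComparisonAgeCompositionJointPolytope

/-!
# EriceRemainderEnclosureHistoryAutonomyComparisonAgeCompositionNestedTwoPairsNear — (E93c) route (N), first order: THE JOINT TWO-PAIR CERTIFICATE IN THE
# RATIO < 2 REGIME (`k₂ < k₃ < 2(k₂+1)`, `E = 2(k₂+1)∕k₃ ≥ 1`).  (E93b) needs `E ≤ 1` for the concavity of the middle residual along `x₃ = σ₂ − x₂`; for
# `E ≥ 1` that residual is CONVEX and bounded below by its value at `x₂ = σ₂∕2` — §0 `joint_polytope_nonneg_convex` — and the flow wiring of (E93b) goes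
# through verbatim: **`flow_nonneg_census_three_ages_two_pairs_near`**.  This is the regime `57 ≤ k₃ ≤ 2k₂+1` (`28 ≤ k₂ ≤ 44`) left between (E90c)
# (`k₃ ≤ 56`) and the bands of (E93d–h); its own rational bands are (E93i–j)

Cell `pub-balaban`, β-function sub-cell, BINDER row D4 «RemainderConst leaves for Bałaban's split» (`HOME/BINDER-OWNERS.md`; owner lineage `b2b-balaban-beta-an4`;
this file by co-owner #2 lineage `b2b-balaban-beta-d4-p2`, generation 83), β-FLOW TEAM duty (1), FREEZE (0) honoured (def-free; nothing restated).

HONEST FRAMING (page 1, verbatim and binding).  *"Discharging BetaPertH makes Bałaban's UV stability UNCONDITIONAL — a real constructive-QFT result; it is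
NOT the continuum limit and NOT the Clay problem."*  THIS FILE DISCHARGES NOTHING OF THE KIND.  Elementary real algebra ∕ real analysis about ABSTRACT
functionals on a box ]0,γ]^ℕ with displayed floors, profiles and signs, and the FIRST-ORDER renewal objects of route (N) built from them — hypotheses of a
census, not facts; the form, signs, ages and moments of Bałaban's (1.22) limit functional are NOT PRINTED ([I] p. 298; GAPS G-t4-U2-1∕-2) and NOT asserted.
Row D4 class UNCHANGED (critical-path width 0; instance 0∕1; D4 DISCHARGE NO DATE).  HONEST DEPENDENCY: continuum YM on T⁴ ⇐ BetaPertH ∧ nine spine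
estimates (0/9 proved); BetaPertH ⇐ (D1) ∧ (D4) ∧ CAP+tail; G-an2-4 gates asym, D1 and NE2/3/4.

THE POINT.  Middle step ((E92c) `residual_step_moment`, `sy = x₂`, the actual `x₃` kept as in (E92f)): `e − O − M ≥ R₂·e`, `R₂ = (1−x₂)(1−x₃) − E x₂x₃`;
young step (`sy = x₁` actual, first moment `c₁ = x₁` as in (E92d)): `ε ≥ [(1−x₁)R₂ − 4x₁(c₂ + c₃)]·e = Φ·e`; both pair bounds from (E92b)
`pair_load_le_of_ratio` (`p₁⁴(k₂+1) ≤ 2`, `p₂⁴(k₃+1) ≤ k₂+1`); `Φ ≥ 0` and `R₂ ≥ 0` from §0.  The abbreviations `s, σ₁, σ₂, E, B, C` enter as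
explicit parameters with defining equations so that the certificate hypotheses are short.  Uses (E93a) `affine_nonneg_between`∕`convex_quad_ge_tangent`, (E92c)
`residual_step_moment`∕`row_moment_le`, (E92b) `pair_load_le_of_ratio`, (E92a) `renewal_bounds_of_step`, (E91a) `old_read_variation`, (E82a)
`kernel_entry_le`∕`row_mass_le`, (E89b) `window_load_le_sqrt_two_div_two`, (E80b) `aggregate_eq_sum` BY NAME.  NOT CLAIMED: the rational instances (they are (E93i–j)); anything printed — NOT B12 Thm 2, NOT BetaPertH.

WHAT IS PROVED ([folklore]; 0 `def`, 0 sorry).  §0 `joint_polytope_nonneg_convex`; §1 **`flow_nonneg_census_three_ages_two_pairs_near`**.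
-/
noncomputable section
open Finset

namespace Summit.QuantumFields.BalabanUV.Beta.EriceRemainderEnclosureHistoryAutonomyComparisonAgeCompositionNestedTwoPairsNear

open Literature.MathematicalPhysics.QuantumFieldTheory.Balaban1983to89
open Literature.MathematicalPhysics.QuantumFieldTheory.Balaban1983to89.T4BetaStationary
open Literature.MathematicalPhysics.QuantumFieldTheory.Balaban1983to89.T4BetaFlowWellPosed
open Summit.QuantumFields.BalabanUV.Beta.EriceRemainderEnclosureHistoryAutonomyComparisonAgeCompositionTwoAgesOldRead (old_read_variation)
open Summit.QuantumFields.BalabanUV.Beta.EriceRemainderEnclosureHistoryAutonomyComparisonAgeCompositionThreeAgesMassCap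
  (window_load_le_sqrt_two_div_two)
open Summit.QuantumFields.BalabanUV.Beta.EriceRemainderEnclosureHistoryAutonomyComparisonAgeCompositionYoungestTailSumFlow
  (kernel_entry_le row_mass_le)
open Summit.QuantumFields.BalabanUV.Beta.EriceRemainderEnclosureHistoryAutonomyComparisonAgeCompositionChainWiring (aggregate_eq_sum)
open Summit.QuantumFields.BalabanUV.Beta.EriceRemainderEnclosureHistoryAutonomyComparisonAgeCompositionNestedReads (renewal_bounds_of_step)
open Summit.QuantumFields.BalabanUV.Beta.EriceRemainderEnclosureHistoryAutonomyComparisonAgeCompositionPairShares (pair_load_le_of_ratio)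
open Summit.QuantumFields.BalabanUV.Beta.EriceRemainderEnclosureHistoryAutonomyComparisonAgeCompositionNestedMoments
  (residual_step_moment row_moment_le)
open Summit.QuantumFields.BalabanUV.Beta.EriceRemainderEnclosureHistoryAutonomyComparisonAgeCompositionJointPolytope (affine_nonneg_between convex_quad_ge_tangent)

variable {B : (ℕ → ℝ) → ℝ} {γ b gIR : ℝ} {L : ℕ → ℝ} {K : ℕ} {h g : ℕ → ℝ}

/-! ## §0 The polytope lemma with a convex middle residual -/

/-- **THE JOINT TWO-PAIR POLYTOPE WITH A CONVEX MIDDLE RESIDUAL (pure; the ratio < 2 regime).**  As (E93a) `joint_polytope_nonneg_guarded`, but for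
`E ≥ 1`: then `R₂(u, σ₂ − u) = (1−σ₂) + (1−E)u(σ₂−u)` is convex in `u` and bounded below globally by its value at `u = σ₂∕2`
(`R₂*(u) − R₂*(σ₂∕2) = (E−1)(u − σ₂∕2)²`), which replaces the concavity data of the last two regimes. [folklore] -/
theorem joint_polytope_nonneg_convex {s σ₁ σ₂ E B C x₁ x₂ x₃ b₁ a₂ ρ₁ ρ₂ ρ₃ ρ₄ : ℝ}
    (hs0 : 0 ≤ s) (hs1 : s ≤ 1)
    (hx1 : 0 ≤ x₁) (hx1s : x₁ ≤ s) (hx2 : 0 ≤ x₂) (hx2s : x₂ ≤ s) (hx3 : 0 ≤ x₃) (hx3s : x₃ ≤ s)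
    (h12 : x₁ + x₂ ≤ σ₁) (h23 : x₂ + x₃ ≤ σ₂)
    (hE0 : 0 ≤ E) (hE1 : 1 ≤ E) (hC0 : 0 ≤ C) (hCB : C ≤ B)
    -- piece A1 (x₂ ≤ σ₁ − s, x₂ ≤ σ₂ − s): certificate point b₁ ≥ min(σ₁, σ₂) − s
    (hb1 : σ₁ - s ≤ b₁ ∨ σ₂ - s ≤ b₁)
    (hρ1 : ρ₁ ≤ (1 - s) - b₁ * ((1 - s) + E * s)) (c1ρ : 0 ≤ ρ₁)
    (c1 : 0 ≤ (1 - s) * ρ₁ - s * (B * b₁ + C * s))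
    -- piece A2 (σ₁ − s < x₂ ≤ σ₂ − s)
    (hρ2 : σ₁ < σ₂ → ρ₂ ≤ (1 - s) - (σ₂ - s) * ((1 - s) + E * s)) (c2ρ : σ₁ < σ₂ → 0 ≤ ρ₂)
    (c2a : σ₁ < σ₂ → 0 ≤ (1 - σ₁ + (σ₁ - s)) * ρ₂ - (σ₁ - (σ₁ - s)) * (B * (σ₁ - s) + C * s))
    (c2b : σ₁ < σ₂ → 0 ≤ (1 - σ₁ + (σ₁ - s)) * ρ₂ - (σ₁ - (σ₁ - s)) * (B * (σ₁ - s) + C * s)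
        + (ρ₂ + (B * (σ₁ - s) + C * s) - (σ₁ - (σ₁ - s)) * B) * ((σ₂ - s) - (σ₁ - s)))
    -- piece B1 (σ₂ − s < x₂ ≤ σ₁ − s)
    (hρ3 : σ₂ < σ₁ → ρ₃ ≤ (1 - σ₂) + (1 - E) * (σ₂ / 2) * (σ₂ - σ₂ / 2)) (c3ρ : σ₂ < σ₁ → 0 ≤ ρ₃)
    (c3 : σ₂ < σ₁ → 0 ≤ (1 - s) * ρ₃ - s * (B * (σ₁ - s) + C * (σ₂ - (σ₁ - s))))
    -- piece B2 (x₂ > σ₁ − s, x₂ > σ₂ − s): certificate point a₂ ≤ max(σ₁, σ₂) − s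
    (ha2 : a₂ ≤ σ₁ - s ∨ a₂ ≤ σ₂ - s)
    (hρ4 : ρ₄ ≤ (1 - σ₂) + (1 - E) * (σ₂ / 2) * (σ₂ - σ₂ / 2)) (c4ρ : 0 ≤ ρ₄)
    (c4a : 0 ≤ (1 - σ₁ + a₂) * ρ₄ - (σ₁ - a₂) * (B * a₂ + C * (σ₂ - a₂)))
    (c4b : 0 ≤ (1 - σ₁ + a₂) * ρ₄ - (σ₁ - a₂) * (B * a₂ + C * (σ₂ - a₂))
        + (ρ₄ + (B * a₂ + C * (σ₂ - a₂)) - (σ₁ - a₂) * (B - C)) * (s - a₂)) :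
    0 ≤ (1 - x₁) * ((1 - x₂) * (1 - x₃) - E * x₂ * x₃) - B * x₁ * x₂ - C * x₁ * x₃
    ∧ 0 ≤ (1 - x₂) * (1 - x₃) - E * x₂ * x₃ := by
  have hB0 : 0 ≤ B := hC0.trans hCB
  have h1x1 : 0 ≤ 1 - x₁ := by linarith
  have h1x2 : 0 ≤ 1 - x₂ := by linarith
  -- the x₃-slopes are ≤ 0: pushing x₃ up to X₃ ≥ x₃ lowers R₂ and Φ
  have push3 : ∀ X₃, x₃ ≤ X₃ →
      (1 - x₂) * (1 - X₃) - E * x₂ * X₃ ≤ (1 - x₂) * (1 - x₃) - E * x₂ * x₃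
      ∧ (1 - x₁) * ((1 - x₂) * (1 - X₃) - E * x₂ * X₃) - B * x₁ * x₂ - C * x₁ * X₃
        ≤ (1 - x₁) * ((1 - x₂) * (1 - x₃) - E * x₂ * x₃) - B * x₁ * x₂ - C * x₁ * x₃ := by
    intro X₃ hX
    have hd : 0 ≤ X₃ - x₃ := sub_nonneg.2 hX
    have h1 := mul_nonneg (add_nonneg h1x2 (mul_nonneg hE0 hx2)) hd
    have h2 := mul_nonneg (add_nonneg (mul_nonneg h1x1 (add_nonneg h1x2 (mul_nonneg hE0 hx2))) (mul_nonneg hC0 hx1)) hd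
    have e1 : (1 - x₂) * (1 - x₃) - E * x₂ * x₃ - ((1 - x₂) * (1 - X₃) - E * x₂ * X₃) = ((1 - x₂) + E * x₂) * (X₃ - x₃) := by ring
    have e2 : (1 - x₁) * ((1 - x₂) * (1 - x₃) - E * x₂ * x₃) - B * x₁ * x₂ - C * x₁ * x₃
        - ((1 - x₁) * ((1 - x₂) * (1 - X₃) - E * x₂ * X₃) - B * x₁ * x₂ - C * x₁ * X₃)
        = ((1 - x₁) * ((1 - x₂) + E * x₂) + C * x₁) * (X₃ - x₃) := by ring
    constructor
    · linarith only [h1, e1]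
    · linarith only [h2, e2]
  -- pushing x₁ up to X₁ ≥ x₁ lowers Φ when R₂ ≥ 0 (at the pushed x₃)
  have push1 : ∀ X₁ X₃, x₁ ≤ X₁ → 0 ≤ X₃ → 0 ≤ (1 - x₂) * (1 - X₃) - E * x₂ * X₃ →
      (1 - X₁) * ((1 - x₂) * (1 - X₃) - E * x₂ * X₃) - B * X₁ * x₂ - C * X₁ * X₃
        ≤ (1 - x₁) * ((1 - x₂) * (1 - X₃) - E * x₂ * X₃) - B * x₁ * x₂ - C * x₁ * X₃ := by
    intro X₁ X₃ hX hX3 hR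
    have hd : 0 ≤ X₁ - x₁ := sub_nonneg.2 hX
    have h1 := mul_nonneg (add_nonneg (add_nonneg hR (mul_nonneg hB0 hx2)) (mul_nonneg hC0 hX3)) hd
    have e1 : (1 - x₁) * ((1 - x₂) * (1 - X₃) - E * x₂ * X₃) - B * x₁ * x₂ - C * x₁ * X₃
        - ((1 - X₁) * ((1 - x₂) * (1 - X₃) - E * x₂ * X₃) - B * X₁ * x₂ - C * X₁ * X₃)
        = (((1 - x₂) * (1 - X₃) - E * x₂ * X₃) + B * x₂ + C * X₃) * (X₁ - x₁) := by ring
    linarith only [h1, e1]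
  rcases le_or_gt x₂ (σ₂ - s) with hA | hB
  · -- x₃* = s
    obtain ⟨hR3, hΦ3⟩ := push3 s hx3s
    rcases le_or_gt x₂ (σ₁ - s) with hA1 | hA2
    · -- A1: x₁* = s; everything decreasing in x₂ ≤ b₁
      have hxb : x₂ ≤ b₁ := by rcases hb1 with h | h <;> linarith
      have hRs : ρ₁ ≤ (1 - x₂) * (1 - s) - E * x₂ * s := by
        have : 0 ≤ (b₁ - x₂) * ((1 - s) + E * s) := mul_nonneg (by linarith) (add_nonneg (by linarith) (mul_nonneg hE0 hs0))
        linarith only [this, hρ1]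
      have hR0 : 0 ≤ (1 - x₂) * (1 - s) - E * x₂ * s := c1ρ.trans hRs
      have hΦ1 := push1 s s hx1s hs0 hR0
      refine ⟨?_, hR0.trans hR3⟩
      -- Φ(s, x₂, s) = (1−s)R₂(x₂,s) − s(Bx₂ + Cs) ≥ (1−s)ρ₁ − s(B b₁ + C s) ≥ 0
      have h1 : (1 - s) * ρ₁ ≤ (1 - s) * ((1 - x₂) * (1 - s) - E * x₂ * s) := mul_le_mul_of_nonneg_left hRs (by linarith)
      have h2 : s * (B * x₂ + C * s) ≤ s * (B * b₁ + C * s) :=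
        mul_le_mul_of_nonneg_left (by linarith [mul_le_mul_of_nonneg_left hxb hB0]) hs0
      linarith only [hΦ3, hΦ1, h1, h2, c1]
    · -- A2: x₁* = σ₁ − x₂ ∈ [0, s); the regime is non-empty, so σ₁ < σ₂
      have hlt : σ₁ < σ₂ := by linarith
      have hX1 : x₁ ≤ σ₁ - x₂ := by linarith
      have hRs : ρ₂ ≤ (1 - x₂) * (1 - s) - E * x₂ * s := by
        have : 0 ≤ ((σ₂ - s) - x₂) * ((1 - s) + E * s) := mul_nonneg (by linarith) (add_nonneg (by linarith) (mul_nonneg hE0 hs0))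
        linarith only [this, hρ2 hlt]
      have hR0 : 0 ≤ (1 - x₂) * (1 - s) - E * x₂ * s := (c2ρ hlt).trans hRs
      have hΦ1 := push1 (σ₁ - x₂) s hX1 hs0 hR0
      refine ⟨?_, hR0.trans hR3⟩
      -- Φ(σ₁−x₂, x₂, s) ≥ (1−σ₁+x₂)ρ₂ − (σ₁−x₂)(Bx₂ + Cs) =: q(x₂), convex in x₂ (coefficient B): tangent at σ₁ − s
      have h1σ : 0 ≤ 1 - (σ₁ - x₂) := by linarith
      have h1 : (1 - (σ₁ - x₂)) * ρ₂ ≤ (1 - (σ₁ - x₂)) * ((1 - x₂) * (1 - s) - E * x₂ * s) := mul_le_mul_of_nonneg_left hRs h1σ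
      have htan := convex_quad_ge_tangent (α := B) (β := ρ₂ + C * s - σ₁ * B) (γ := (1 - σ₁) * ρ₂ - σ₁ * C * s) (a := σ₁ - s) (u := x₂) hB0
      have hline := affine_nonneg_between (t₀ := σ₁ - s) (t₁ := σ₂ - s) (t := x₂) (c2a hlt) (c2b hlt) hA2.le hA
      linarith only [h1, htan, hline, hΦ1, hΦ3]
  · -- x₃* = σ₂ − x₂ ∈ [0, s)
    have hX3 : x₃ ≤ σ₂ - x₂ := by linarith
    have hX30 : 0 ≤ σ₂ - x₂ := hx3.trans hX3
    obtain ⟨hR3, hΦ3⟩ := push3 (σ₂ - x₂) hX3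
    -- R₂(x₂, σ₂ − x₂) = (1 − σ₂) + (1−E) x₂ (σ₂ − x₂)
    have eR : (1 - x₂) * (1 - (σ₂ - x₂)) - E * x₂ * (σ₂ - x₂) = (1 - σ₂) + (1 - E) * x₂ * (σ₂ - x₂) := by ring
    rcases le_or_gt x₂ (σ₁ - s) with hB1 | hB2
    · -- B1: x₁* = s; the regime is non-empty, so σ₂ < σ₁; R₂* ≥ ρ₃ by concavity on [σ₂ − s, σ₁ − s]
      have hlt : σ₂ < σ₁ := by linarith
      have hRs : ρ₃ ≤ (1 - σ₂) + (1 - E) * x₂ * (σ₂ - x₂) := by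
        have e : (1 - σ₂) + (1 - E) * x₂ * (σ₂ - x₂) - ((1 - σ₂) + (1 - E) * (σ₂ / 2) * (σ₂ - σ₂ / 2)) = (E - 1) * (x₂ - σ₂ / 2) ^ 2 := by ring
        have := mul_nonneg (sub_nonneg.2 hE1) (sq_nonneg (x₂ - σ₂ / 2))
        linarith [hρ3 hlt, e, this]
      have hR0 : 0 ≤ (1 - x₂) * (1 - (σ₂ - x₂)) - E * x₂ * (σ₂ - x₂) := by rw [eR]; exact (c3ρ hlt).trans hRs
      have hΦ1 := push1 s (σ₂ - x₂) hx1s hX30 hR0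
      refine ⟨?_, hR0.trans hR3⟩
      have h1 : (1 - s) * ρ₃ ≤ (1 - s) * ((1 - σ₂) + (1 - E) * x₂ * (σ₂ - x₂)) := mul_le_mul_of_nonneg_left hRs (by linarith)
      -- remainder affine decreasing in x₂ (slope −s(B − C) ≤ 0): evaluate at σ₁ − s
      have h2 : s * (B * x₂ + C * (σ₂ - x₂)) ≤ s * (B * (σ₁ - s) + C * (σ₂ - (σ₁ - s))) := by
        have : 0 ≤ s * (B - C) * ((σ₁ - s) - x₂) := mul_nonneg (mul_nonneg hs0 (by linarith)) (by linarith)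
        linarith only [this]
      linarith only [hΦ1, hΦ3, h1, h2, eR, c3 hlt]
    · -- B2: x₁* = σ₁ − x₂; R₂* ≥ ρ₄ by concavity on [a₂, s]
      have hX1 : x₁ ≤ σ₁ - x₂ := by linarith
      have ha2x : a₂ ≤ x₂ := by rcases ha2 with h | h <;> linarith
      have hRs : ρ₄ ≤ (1 - σ₂) + (1 - E) * x₂ * (σ₂ - x₂) := by
        have e : (1 - σ₂) + (1 - E) * x₂ * (σ₂ - x₂) - ((1 - σ₂) + (1 - E) * (σ₂ / 2) * (σ₂ - σ₂ / 2)) = (E - 1) * (x₂ - σ₂ / 2) ^ 2 := by ring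
        have := mul_nonneg (sub_nonneg.2 hE1) (sq_nonneg (x₂ - σ₂ / 2))
        linarith [hρ4, e, this]
      have hR0 : 0 ≤ (1 - x₂) * (1 - (σ₂ - x₂)) - E * x₂ * (σ₂ - x₂) := by rw [eR]; exact c4ρ.trans hRs
      have hΦ1 := push1 (σ₁ - x₂) (σ₂ - x₂) hX1 hX30 hR0
      refine ⟨?_, hR0.trans hR3⟩
      have h1σ : 0 ≤ 1 - (σ₁ - x₂) := by linarith
      have h1 : (1 - (σ₁ - x₂)) * ρ₄ ≤ (1 - (σ₁ - x₂)) * ((1 - σ₂) + (1 - E) * x₂ * (σ₂ - x₂)) := mul_le_mul_of_nonneg_left hRs h1σ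
      -- q(u) = (1−σ₁+u)ρ₄ − (σ₁−u)(Bu + C(σ₂−u)) = (B − C)u² + (ρ₄ + Cσ₂ − σ₁(B − C)·1 … ) : convex, tangent at a₂
      have htan := convex_quad_ge_tangent (α := B - C) (β := ρ₄ + C * σ₂ - σ₁ * (B - C)) (γ := (1 - σ₁) * ρ₄ - σ₁ * C * σ₂) (a := a₂) (u := x₂)
        (by linarith)
      have hline := affine_nonneg_between (t₀ := a₂) (t₁ := s) (t := x₂) c4a c4b ha2x hx2s
      linarith only [h1, htan, hline, hΦ1, hΦ3, eR]

/-! ## §1 The flow wiring -/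

/-- **THE CENSUS THREE AGES `{1, k₂, k₃}` FROM THE JOINT TWO-PAIR CERTIFICATE, RATIO BELOW 2.**  Profile carried by `{1, k₂, k₃}`, `2 ≤ k₂ < k₃ < K`;
dampings of the self-consistent class `g_t(1+F_t) ≥ 1`; `p₁, p₂ ≥ 0` with `p₁⁴(k₂+1) ≤ 2`, `p₂⁴(k₃+1) ≤ k₂+1`; abbreviations `s = √2∕2` (or any `s ∈ [√2∕2, 1]`), `σ₁ = √2∕(1+p₁)`,
`σ₂ = √2∕(1+p₂)`, `E = 2(k₂+1)∕k₃`, here with `E ≥ 1`, `Bc = 4∕k₂`, `Cc = 4∕k₃` — or ANY UPPER BOUNDS of these (`σ₁, σ₂, E, Bc, Cc` are parameters bounded from below by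
the actual values: `Φ` is non-increasing in `E, Bc, Cc` and the polytope grows with `σ₁, σ₂`, so one certificate serves a whole band of `(k₂, k₃)`);
certificate data `b₁, a₂, ρ₁, ρ₂, ρ₃, ρ₄` satisfying the displayed inequalities of §0 `joint_polytope_nonneg_convex`.  Then `0 ≤ ε ≤ e` at every pin for every
admissible excess and every horizon. [folklore] -/
theorem flow_nonneg_census_three_ages_two_pairs_near (hmono : ∀ u v : ℕ → ℝ, SeqBox γ u → SeqBox γ v → (∀ j, u j ≤ v j) → B u ≤ B v)
    (hL : ∀ k, 0 ≤ L k) (hb : 0 < b) (hlo : ∀ u, SeqBox γ u → b ≤ B u) (hdom : ∀ u, SeqBox γ u → ∑ k ∈ range K, L k * u k ≤ B u)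
    (hh : SeqBox γ h) (hf : MemFlow B gIR h) (hg : ∀ t, 0 < g t ∧ g t ≤ 1)
    (hgF : ∀ t, 1 ≤ g t * (1 + ∑ k ∈ range K, L k * h (t + k) ^ 3 / 2))
    {k₂ k₃ : ℕ} (hk2 : 2 ≤ k₂) (hk23 : k₂ < k₃) (hk3K : k₃ < K) (hL3 : ∀ j, j < K → j ≠ 1 → j ≠ k₂ → j ≠ k₃ → L j = 0)
    {p₁ p₂ : ℝ} (hp10 : 0 ≤ p₁) (hp1 : p₁ ^ 4 * ((k₂ : ℝ) + 1) ≤ 2) (hp20 : 0 ≤ p₂) (hp2 : p₂ ^ 4 * ((k₃ : ℝ) + 1) ≤ (k₂ : ℝ) + 1)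
    {s σ₁ σ₂ E Bc Cc : ℝ} (hs : Real.sqrt 2 / 2 ≤ s) (hs1 : s ≤ 1) (hσ1 : Real.sqrt 2 / (1 + p₁) ≤ σ₁) (hσ2 : Real.sqrt 2 / (1 + p₂) ≤ σ₂)
    (hE : 2 * ((k₂ : ℝ) + 1) / k₃ ≤ E) (hE1 : 1 ≤ E) (hBc : 4 / (k₂ : ℝ) ≤ Bc) (hCc : 4 / (k₃ : ℝ) ≤ Cc) (hCB : Cc ≤ Bc)
    {b₁ a₂ ρ₁ ρ₂ ρ₃ ρ₄ : ℝ}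
    (hb1 : σ₁ - s ≤ b₁ ∨ σ₂ - s ≤ b₁)
    (hρ1 : ρ₁ ≤ (1 - s) - b₁ * ((1 - s) + E * s)) (c1ρ : 0 ≤ ρ₁)
    (cert1 : 0 ≤ (1 - s) * ρ₁ - s * (Bc * b₁ + Cc * s))
    (hρ2 : σ₁ < σ₂ → ρ₂ ≤ (1 - s) - (σ₂ - s) * ((1 - s) + E * s)) (c2ρ : σ₁ < σ₂ → 0 ≤ ρ₂)
    (cert2a : σ₁ < σ₂ → 0 ≤ (1 - σ₁ + (σ₁ - s)) * ρ₂ - (σ₁ - (σ₁ - s)) * (Bc * (σ₁ - s) + Cc * s))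
    (cert2b : σ₁ < σ₂ → 0 ≤ (1 - σ₁ + (σ₁ - s)) * ρ₂ - (σ₁ - (σ₁ - s)) * (Bc * (σ₁ - s) + Cc * s)
        + (ρ₂ + (Bc * (σ₁ - s) + Cc * s) - (σ₁ - (σ₁ - s)) * Bc) * ((σ₂ - s) - (σ₁ - s)))
    (hρ3 : σ₂ < σ₁ → ρ₃ ≤ (1 - σ₂) + (1 - E) * (σ₂ / 2) * (σ₂ - σ₂ / 2)) (c3ρ : σ₂ < σ₁ → 0 ≤ ρ₃)
    (cert3 : σ₂ < σ₁ → 0 ≤ (1 - s) * ρ₃ - s * (Bc * (σ₁ - s) + Cc * (σ₂ - (σ₁ - s))))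
    (ha2 : a₂ ≤ σ₁ - s ∨ a₂ ≤ σ₂ - s)
    (hρ4 : ρ₄ ≤ (1 - σ₂) + (1 - E) * (σ₂ / 2) * (σ₂ - σ₂ / 2)) (c4ρ : 0 ≤ ρ₄)
    (cert4a : 0 ≤ (1 - σ₁ + a₂) * ρ₄ - (σ₁ - a₂) * (Bc * a₂ + Cc * (σ₂ - a₂)))
    (cert4b : 0 ≤ (1 - σ₁ + a₂) * ρ₄ - (σ₁ - a₂) * (Bc * a₂ + Cc * (σ₂ - a₂))
        + (ρ₄ + (Bc * a₂ + Cc * (σ₂ - a₂)) - (σ₁ - a₂) * (Bc - Cc)) * (s - a₂))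
    {N : ℕ} {KL : ℕ → ℕ → ℕ → ℝ}
    (hKL : ∀ k n l, KL k n l = if 0 < k ∧ k < K ∧ l < k then L k * h (n + k) ^ 3 / 2 * ∏ t ∈ Ico (n + 1 + l) (n + k + 1), g t else 0)
    {KA : ℕ → ℕ → ℕ → ℝ} {RA : ℕ → (ℕ → ℝ) → ℕ → ℝ}
    (hRA : ∀ i v m, RA i v m = ∑ l ∈ range K, KA i m l * v (m + 1 + l))
    (hKA : ∀ i m l, KA i m l = KL i m l + KA (i + 1) m l) (hKAtop : ∀ m l, KA K m l = 0)
    {e ε : ℕ → ℝ} (he0 : ∀ m, 0 ≤ e m) (hea : ∀ m, e (m + 1) ≤ e m)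
    (hεt : ∀ m, N < m → ε m = 0) (hεrec : ∀ m, ε m = e m - RA 1 ε m) : ∀ m, 0 ≤ ε m ∧ ε m ≤ e m := by
  have hpos : ∀ n, 0 < h n := fun n => (hh n).1
  have h1K : 1 < K := by omega
  have hk2K : k₂ < K := by omega
  have hj : 0 < k₂ := by omega
  have hk : 0 < k₃ := by omega
  have hK : 1 ≤ K := by omega
  have hL0 : L 0 = 0 := hL3 0 (by omega) (by omega) (by omega) (by omega)
  have hs0r : 0 ≤ Real.sqrt 2 := Real.sqrt_nonneg 2
  have hs17 : Real.sqrt 2 ≤ 17 / 12 := Real.sqrt_le_iff.mpr ⟨by norm_num, by norm_num⟩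
  have hjr : (0 : ℝ) < k₂ := by exact_mod_cast hj
  have hkr : (0 : ℝ) < k₃ := by exact_mod_cast hk
  have hk2ne : (k₂ : ℝ) ≠ 0 := hjr.ne'
  have hk3ne : (k₃ : ℝ) ≠ 0 := hkr.ne'
  have hea' : ∀ p q, p ≤ q → e q ≤ e p := by
    intro p q hpq
    induction q, hpq using Nat.le_induction with
    | base => exact le_rfl
    | succ q _ ih => exact (hea q).trans ih
  -- the abbreviations' elementary facts
  have hs0 : 0 ≤ s := le_trans (by positivity) hs
  have hE0 : 0 ≤ E := le_trans (by positivity) hE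
  have hC0 : 0 ≤ Cc := le_trans (by positivity) hCc
  have hB0 : 0 ≤ Bc := hC0.trans hCB
  -- the aggregate row is the young row plus the middle row plus the old row
  have hKA1 : ∀ m l, KA 1 m l = KL 1 m l + (KL k₂ m l + KL k₃ m l) := by
    intro m l
    have h1 : KA 1 m l = ∑ k' ∈ Ico 1 (K - 1 + 1), KL k' m l :=
      aggregate_eq_sum (n := K - 1) hKA (fun m l => by rw [Nat.sub_add_cancel hK]; exact hKAtop m l) (show 1 ≤ K - 1 + 1 by omega) m l
    rw [h1, Nat.sub_add_cancel hK]
    have hsub : ({1, k₂, k₃} : Finset ℕ) ⊆ Ico 1 K := by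
      intro x hx
      simp only [mem_insert, mem_singleton] at hx
      rw [mem_Ico]; rcases hx with rfl | rfl | rfl <;> omega
    rw [← sum_subset hsub (fun x hx hxn => by
      simp only [mem_insert, mem_singleton, not_or] at hxn
      rw [hKL]
      split_ifs
      · rw [hL3 x (mem_Ico.mp hx).2 hxn.1 hxn.2.1 hxn.2.2]; simp
      · rfl), sum_insert (by simp only [mem_insert, mem_singleton]; omega), sum_pair (by omega)]
  have hrec3 : ∀ p, ε p = e p - ∑ l ∈ range K, KL 1 p l * ε (p + 1 + l)
      - (∑ l ∈ range K, KL k₂ p l * ε (p + 1 + l) + ∑ l ∈ range K, KL k₃ p l * ε (p + 1 + l)) := by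
    intro p
    rw [hεrec p, hRA]
    have : ∑ l ∈ range K, KA 1 p l * ε (p + 1 + l) = ∑ l ∈ range K, KL 1 p l * ε (p + 1 + l)
        + (∑ l ∈ range K, KL k₂ p l * ε (p + 1 + l) + ∑ l ∈ range K, KL k₃ p l * ε (p + 1 + l)) := by
      rw [← sum_add_distrib, ← sum_add_distrib]; exact sum_congr rfl fun l _ => by rw [hKA1]; ring
    rw [this]; ring
  refine renewal_bounds_of_step he0 hεt fun m IH => ?_
  have hread0 : ∀ a p, m ≤ p → 0 ≤ ∑ l ∈ range K, KL a p l * ε (p + 1 + l) := fun a p hp =>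
    sum_nonneg fun l _ => mul_nonneg (kernel_entry_le hL hh hg hKL a p l).1 (IH _ (by omega)).1
  have hreadle : ∀ {a : ℕ}, a < K → ∑ l ∈ range K, KL a m l * ε (m + 1 + l) ≤ (a : ℝ) * (L a * h (m + a) ^ 3 / 2) * e m := by
    intro a haK
    calc ∑ l ∈ range K, KL a m l * ε (m + 1 + l) ≤ ∑ l ∈ range K, KL a m l * e m :=
          sum_le_sum fun l _ => mul_le_mul_of_nonneg_left
            (((IH _ (by omega)).2).trans (hea' m (m + 1 + l) (by omega))) (kernel_entry_le hL hh hg hKL a m l).1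
      _ = (∑ l ∈ range K, KL a m l) * e m := by rw [sum_mul]
      _ ≤ (a : ℝ) * (L a * h (m + a) ^ 3 / 2) * e m := mul_le_mul_of_nonneg_right (row_mass_le hL hh hg hKL haK m) (he0 m)
  -- the three loads at the pin and BOTH pair share bounds
  have hx1' := window_load_le_sqrt_two_div_two hmono hL hb hlo hdom hh hf h1K m
  have hx2 := window_load_le_sqrt_two_div_two hmono hL hb hlo hdom hh hf hk2K m
  have hx3 := window_load_le_sqrt_two_div_two hmono hL hb hlo hdom hh hf hk3K m
  have hpair1' := pair_load_le_of_ratio hmono hL hb hlo hdom hh hf le_rfl (show 1 < k₂ by omega) hk2K hp10 (by push_cast; linarith) m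
  have hpair2' := pair_load_le_of_ratio hmono hL hb hlo hdom hh hf (show 1 ≤ k₂ by omega) (show k₂ < k₃ by omega) hk3K hp20 hp2 m
  set c1 := L 1 * h (m + 1) ^ 3 / 2 with hc1_def
  set c2 := L k₂ * h (m + k₂) ^ 3 / 2 with hc2_def
  set c3 := L k₃ * h (m + k₃) ^ 3 / 2 with hc3_def
  have hc10 : 0 ≤ c1 := by have := hL 1; have := hpos (m + 1); positivity
  have hc20 : 0 ≤ c2 := by have := hL k₂; have := hpos (m + k₂); positivity
  have hc30 : 0 ≤ c3 := by have := hL k₃; have := hpos (m + k₃); positivity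
  have hx1 : c1 ≤ s := le_trans (by simpa using hx1') hs
  have hpair1 : c1 + (k₂ : ℝ) * c2 ≤ σ₁ := le_trans (by simpa using hpair1') hσ1
  have hpair2 : (k₂ : ℝ) * c2 + (k₃ : ℝ) * c3 ≤ σ₂ := hpair2'.trans hσ2
  have hx2s : (k₂ : ℝ) * c2 ≤ s := hx2.trans hs
  have hx3s : (k₃ : ℝ) * c3 ≤ s := hx3.trans hs
  have hem := he0 m
  -- the joint polytope: Φ ≥ 0 and R₂ ≥ 0 at the actual loads
  obtain ⟨hΦ, hR2⟩ := joint_polytope_nonneg_convex (B := Bc) (C := Cc) hs0 hs1 hc10 hx1 (mul_nonneg (Nat.cast_nonneg _) hc20) hx2s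
    (mul_nonneg (Nat.cast_nonneg _) hc30) hx3s hpair1 hpair2 hE0 hE1 hC0 hCB hb1 hρ1 c1ρ cert1 hρ2 c2ρ cert2a cert2b hρ3 c3ρ cert3 ha2
    hρ4 c4ρ cert4a cert4b
  -- unit conversions between loads and lag-zero coefficients (the parameters are upper bounds of the actual `4∕k₂, 4∕k₃, 2(k₂+1)∕k₃`)
  have e1 : 4 * c1 * c2 ≤ Bc * c1 * ((k₂ : ℝ) * c2) := by
    have e : 4 / (k₂ : ℝ) * c1 * ((k₂ : ℝ) * c2) = 4 * c1 * c2 := by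
      rw [div_mul_eq_mul_div, div_mul_eq_mul_div, div_eq_iff hk2ne]; ring
    have := mul_le_mul_of_nonneg_right hBc (mul_nonneg hc10 (mul_nonneg (Nat.cast_nonneg k₂) hc20))
    linarith [e, this]
  have e2 : 4 * c1 * c3 ≤ Cc * c1 * ((k₃ : ℝ) * c3) := by
    have e : 4 / (k₃ : ℝ) * c1 * ((k₃ : ℝ) * c3) = 4 * c1 * c3 := by
      rw [div_mul_eq_mul_div, div_mul_eq_mul_div, div_eq_iff hk3ne]; ring
    have := mul_le_mul_of_nonneg_right hCc (mul_nonneg hc10 (mul_nonneg (Nat.cast_nonneg k₃) hc30))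
    linarith [e, this]
  have e3 : 2 * ((k₂ : ℝ) * c2) * ((k₂ : ℝ) + 1) * c3 ≤ E * ((k₂ : ℝ) * c2) * ((k₃ : ℝ) * c3) := by
    have e : 2 * ((k₂ : ℝ) + 1) / k₃ * ((k₂ : ℝ) * c2) * ((k₃ : ℝ) * c3) = 2 * ((k₂ : ℝ) * c2) * ((k₂ : ℝ) + 1) * c3 := by
      rw [div_mul_eq_mul_div, div_mul_eq_mul_div, div_eq_iff hk3ne]; ring
    have := mul_le_mul_of_nonneg_right hE (mul_nonneg (mul_nonneg (Nat.cast_nonneg k₂) hc20) (mul_nonneg (Nat.cast_nonneg k₃) hc30))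
    linarith [e, this]
  -- STEP 1 (old residual): e − O ≥ (1 − x₃)e ≥ 0
  have hOle : ∑ l ∈ range K, KL k₃ m l * ε (m + 1 + l) ≤ (k₃ : ℝ) * c3 * e m := hreadle hk3K
  have hres1 : (1 - (k₃ : ℝ) * c3) * e m ≤ e m - ∑ l ∈ range K, KL k₃ m l * ε (m + 1 + l) := by linarith only [hOle]
  have hx3le1 : 0 ≤ 1 - (k₃ : ℝ) * c3 := by linarith
  have hres1' : 0 ≤ e m - ∑ l ∈ range K, KL k₃ m l * ε (m + 1 + l) := le_trans (mul_nonneg hx3le1 hem) hres1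
  -- STEP 2 (middle against old, actual loads)
  have hW2 : ∑ l ∈ range K, KL k₂ m l ≤ (k₂ : ℝ) * c2 := row_mass_le hL hh hg hKL hk2K m
  have hstep2 := residual_step_moment (i := k₂) (Kw := K) (m := m) (sy := (k₂ : ℝ) * c2) (V := 4 * c3)
    (M₁ := c2 * ((k₂ : ℝ) * ((k₂ : ℝ) + 1) / 2))
    (wy := fun l => KL k₂ m l) (O := fun p => ∑ l ∈ range K, KL k₃ p l * ε (p + 1 + l)) (e := e) (ε := ε)
    (fun l => (kernel_entry_le hL hh hg hKL k₂ m l).1) (fun l hl => by rw [hKL, if_neg (by omega)])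
    hW2 (row_moment_le hL hh hg hKL hk2K m) (by positivity) he0 hea
    (fun q hq => by
      have := hrec3 q
      have h1 := hread0 1 q hq.le
      have h2 := hread0 k₂ q hq.le
      linarith only [this, h1, h2])
    hres1'
    (fun d hd1 hdj => by
      have hdk : d ≤ k₃ := by omega
      have hv' := old_read_variation hmono hL hb hlo hdom hh hf hL0 hg hgF hKL hk hk3K hd1 hdk he0 hea IH
      rw [← hc3_def] at hv'
      linarith only [hv'])
  have hR2' : ((1 - (k₂ : ℝ) * c2) * (1 - (k₃ : ℝ) * c3) - E * ((k₂ : ℝ) * c2) * ((k₃ : ℝ) * c3)) * e m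
      ≤ e m - (∑ l ∈ range K, KL k₂ m l * ε (m + 1 + l) + ∑ l ∈ range K, KL k₃ m l * ε (m + 1 + l)) := by
    have hx2le1 : 0 ≤ 1 - (k₂ : ℝ) * c2 := by linarith
    have h1 := mul_le_mul_of_nonneg_left hres1 hx2le1
    have e4 : c2 * ((k₂ : ℝ) * ((k₂ : ℝ) + 1) / 2) * (4 * c3) * e m = 2 * ((k₂ : ℝ) * c2) * ((k₂ : ℝ) + 1) * c3 * e m := by ring
    have e3m := mul_le_mul_of_nonneg_right e3 hem
    linarith only [hstep2, h1, e4, e3m]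
  have hres2' : 0 ≤ e m - (∑ l ∈ range K, KL k₂ m l * ε (m + 1 + l) + ∑ l ∈ range K, KL k₃ m l * ε (m + 1 + l)) :=
    le_trans (mul_nonneg hR2 hem) hR2'
  -- STEP 3 (young against both, actual load x₁ = c₁, first moment c₁)
  have hW1 : ∑ l ∈ range K, KL 1 m l ≤ c1 :=
    (row_mass_le hL hh hg hKL h1K m).trans (le_of_eq (by rw [hc1_def]; simp))
  have hM1 : ∑ l ∈ range K, KL 1 m l * ((l : ℝ) + 1) ≤ c1 :=
    (row_moment_le hL hh hg hKL h1K m).trans (le_of_eq (by rw [hc1_def]; norm_num))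
  have hstep3 := residual_step_moment (i := 1) (Kw := K) (m := m) (sy := c1) (V := 4 * (c2 + c3)) (M₁ := c1)
    (wy := fun l => KL 1 m l)
    (O := fun p => ∑ l ∈ range K, KL k₂ p l * ε (p + 1 + l) + ∑ l ∈ range K, KL k₃ p l * ε (p + 1 + l)) (e := e) (ε := ε)
    (fun l => (kernel_entry_le hL hh hg hKL 1 m l).1) (fun l hl => by rw [hKL, if_neg (by omega)])
    hW1 hM1 (by positivity) he0 hea
    (fun q hq => by
      have := hrec3 q
      have h1 := hread0 1 q hq.le
      linarith only [this, h1])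
    hres2'
    (fun d hd1 hdi => by
      have hdj : d ≤ k₂ := by omega
      have hdk : d ≤ k₃ := by omega
      have hvj := old_read_variation hmono hL hb hlo hdom hh hf hL0 hg hgF hKL hj hk2K hd1 hdj he0 hea IH
      have hvk := old_read_variation hmono hL hb hlo hdom hh hf hL0 hg hgF hKL hk hk3K hd1 hdk he0 hea IH
      rw [← hc2_def] at hvj
      rw [← hc3_def] at hvk
      linarith only [hvj, hvk])
  -- assemble: ε ≥ (1−x₁)·R₂·e − 4c₁(c₂+c₃)e = Φ·e ≥ 0
  have hεm : ε m = e m - ∑ l ∈ range K, KL 1 m l * ε (m + 1 + l)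
      - (∑ l ∈ range K, KL k₂ m l * ε (m + 1 + l) + ∑ l ∈ range K, KL k₃ m l * ε (m + 1 + l)) := hrec3 m
  refine ⟨?_, ?_⟩
  · have hx1le1 : 0 ≤ 1 - c1 := by linarith
    have h1 := mul_le_mul_of_nonneg_left hR2' hx1le1
    have e1m := mul_le_mul_of_nonneg_right e1 hem
    have e2m := mul_le_mul_of_nonneg_right e2 hem
    have hge : ((1 - c1) * ((1 - (k₂ : ℝ) * c2) * (1 - (k₃ : ℝ) * c3) - E * ((k₂ : ℝ) * c2) * ((k₃ : ℝ) * c3))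
          - Bc * c1 * ((k₂ : ℝ) * c2) - Cc * c1 * ((k₃ : ℝ) * c3)) * e m
        ≤ e m - ∑ l ∈ range K, KL 1 m l * ε (m + 1 + l)
          - (∑ l ∈ range K, KL k₂ m l * ε (m + 1 + l) + ∑ l ∈ range K, KL k₃ m l * ε (m + 1 + l)) := by
      linarith only [hstep3, h1, e1m, e2m]
    rw [hεm]
    exact le_trans (mul_nonneg hΦ hem) hge
  · rw [hεm]
    linarith only [hread0 1 m le_rfl, hread0 k₂ m le_rfl, hread0 k₃ m le_rfl]

end Summit.QuantumFields.BalabanUV.Beta.EriceRemainderEnclosureHistoryAutonomyComparisonAgeCompositionNestedTwoPairsNear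

end
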